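import Summits.QuantumFields.YangMills.Theorems.ColdStartUniversalityLatticeLangevinWilsonSpectralGapColdStartEvents
import Summits.QuantumFields.YangMills.Theorems.ColdStartUniversalityUniformColdStartMixingFixedCutoffEntropy
import Summits.QuantumFields.YangMills.Theorems.ColdStartUniversalityUniformColdStartMixingPinskerStep
import HarnessLib

/-!
# Route `ColdStartUniversality`, crux K_A1 `UniformColdStartMixing` (stmt-QuantumFields-24809), line «cold_entropy»:
# the `L²` VARIANT of the node `PinskerStep` — (K-uniform SPECTRAL GAP in physical units) + (K-uniform cold-start χ² BUDGET)
# ⇒ `PointwiseMixing`, kernel-checked; both hypotheses DECIDED at each fixed cut-off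

Helper file (seat `ym-line-csu-p1`, g16; `--supports stmt-QuantumFields-24809`).  The registered line «cold_entropy» closes the
shared node `PointwiseMixing` from an ENTROPY budget (`stub_coldEntropyBudget`) and an ENTROPY dissipation of log-Sobolev type
(`stub_entropyDissipation`) via Pinsker (`pinskerStep`, g10).  This file records the Hilbert-space twin of that composition, which
the `L²(μ_K)` package of this seat (g15 reversibility, g16 spectral gap) makes natural:

* ★★ `chiSquareStep` — HYPOTHESES (spelled out, no new definitions):
  (H1) UNIFORM `L²` GAP IN PHYSICAL UNITS: `∃ γ₁ > 0 ∀ F, 0 < γ ≤ γ₁ ∃ c > 0 ∃ K₀ ∀ K ≥ K₀`, for every Markov kernel family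
       realising the SZZ transition laws at `β'_K = (γ ε_K)⁻¹/2` and every measurable `|G| ≤ 1`, `t ≥ 0`:
       `∫ (κ_t G − μ_K G)² dμ_K ≤ e^{−2c ε_K t} ∫ (G − μ_K G)² dμ_K` (`μ_K` the Wilson measure; the gap is `c ε_K` per unit
       LATTICE time, i.e. `c` per unit PHYSICAL time — a Poincaré inequality for `μ_K` with constant `≍ 1/(c ε_K)`);
  (H2) UNIFORM COLD-START χ² BUDGET at a positive physical time (dual form): `∃ γ₁ > 0 ∀ F, 0 < γ ≤ γ₁ ∃ s₀ > 0, X₀ ≥ 0, K₀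
       ∀ K ≥ K₀`, every cold-start solution `U` on any space and every measurable `|G| ≤ 1`:
       `(E G(U(s₀/ε_K)) − μ_K G)² ≤ X₀ · Var_{μ_K}(G)` (equivalently `χ²(law U(s₀/ε_K) ‖ μ_K) ≤ X₀`);
  CONCLUSION: the node `PointwiseMixing` VERBATIM (as in `pinskerStep`), with `γ₁ := min`, `K₀ := max`,
  `T_c := s₀ + T`, `X₀ e^{−2cT} ≤ η²`.  Proof: Markov/Chapman–Kolmogorov `E G(U_{t₀+t}) = E (κ_tG)(U_{t₀})`, (H2) on `κ_tG`,
  invariance `μ_K(κ_tG) = μ_K G`, (H1), `Var(G) ≤ 1` — Cauchy–Schwarz replaces Pinsker.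
* `uniformL2Gap_fixedCutoff`, `coldChiSquareBudget_fixedCutoff` — THE RUNGS: at each FIXED cut-off both hypotheses hold
  (`wilson_spectralGap_measurable`, `coldStart_measurable_sq_sub_le_exp`); the content of (H1)/(H2) is K-uniformity only.

WHY RECORD IT (planner-facing, honest): (H1) is a POINCARÉ inequality in physical units — weaker than the log-Sobolev input of
`stub_entropyDissipation`; the price is (H2), a χ² budget, which is STRONGER than the entropy budget `stub_coldEntropyBudget`
(`KL ≤ log(1+χ²)`).  In the free-field heuristic both budgets are sums over momentum modes of `O(e^{−4κ_k s₀})` and are K-uniform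
together; the sup-density constant `D_K` of the fixed-cut-off rungs is NOT (it is `exp(#links)`).  Nothing here is uniform in the
cut-off; this is a reshaping OPTION for the planner of record, not a new line; no rung of the ladder, crux or summit statement is
proved; the Yang–Mills mass gap is NOT proved.
-/

set_option autoImplicit false

noncomputable section

namespace Summit.QuantumFields.YangMills.Theorems.ColdStartUniversality

open MeasureTheory ProbabilityTheory
open scoped NNReal ENNReal
open Literature.Probability.Process Literature.MathematicalPhysics.QuantumFieldTheory
open Literature.MathematicalPhysics.QuantumLattice (fundamentalRep fundamentalLatticeRep continuous_fundamentalRep)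
open Literature.MathematicalPhysics.QuantumFieldTheory.Balaban1983to89

/-- The variance of an observable bounded by `1` is at most `1` (probability measure). [folklore] -/
theorem integral_sub_integral_sq_le_one {Y : Type*} [MeasurableSpace Y] (ν : Measure Y) [IsProbabilityMeasure ν]
    {G : Y → ℝ} (hG : Measurable G) (h1 : ∀ y, |G y| ≤ 1) :
    ∫ y, (G y - ∫ z, G z ∂ν) ^ 2 ∂ν ≤ 1 := by
  have hLp : MemLp G 2 ν :=
    MemLp.of_bound hG.aestronglyMeasurable 1 (ae_of_all _ fun y => by rw [Real.norm_eq_abs]; exact h1 y)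
  have hvar : variance G ν = ∫ y, (G y - ∫ z, G z ∂ν) ^ 2 ∂ν := variance_eq_integral hG.aemeasurable
  rw [← hvar, variance_eq_sub hLp]
  have h2 : ν[G ^ 2] ≤ 1 := by
    have : ∫ y, (G ^ 2) y ∂ν ≤ ∫ _y, (1 : ℝ) ∂ν := by
      refine integral_mono_of_nonneg (ae_of_all _ fun y => sq_nonneg (G y)) (integrable_const _)
        (ae_of_all _ fun y => ?_)
      have h := h1 y
      rw [abs_le] at h
      show G y ^ 2 ≤ 1
      nlinarith [h.1, h.2]
    simpa using this
  nlinarith [sq_nonneg (ν[G])]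

/-- ★★ **`chiSquareStep`** — the `L²` twin of `pinskerStep`: a K-uniform `L²(μ_K)` spectral gap of the SZZ dynamics in PHYSICAL
units (H1) and a K-uniform cold-start χ² budget at a positive physical time (H2, dual form) imply the node `PointwiseMixing` of the
registered line «cold_entropy» (statement verbatim).  Markov + invariance + Cauchy–Schwarz; no Pinsker, no log-Sobolev.
[cite: RobertsRosenthal1997, Theorem 2.1] [cite: ShenZhuZhu2022, §3 Lemma 3.3 (p. 13)] -/
theorem chiSquareStep :
    (∃ γ₁ : ℝ, 0 < γ₁ ∧ ∀ (F : T3ContinuumYM3Torus.T3Family) (γ : ℝ), 0 < γ → γ ≤ γ₁ →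
      ∃ c : ℝ, 0 < c ∧ ∃ K₀ : ℕ, ∀ K : ℕ, K₀ ≤ K →
        ∀ (κ : ℝ≥0 → Kernel (GaugeConfig 3 ((F.P K).sitesPerDir 0) (Matrix.specialUnitaryGroup (Fin 2) ℂ))
            (GaugeConfig 3 ((F.P K).sitesPerDir 0) (Matrix.specialUnitaryGroup (Fin 2) ℂ))) [∀ t, IsMarkovKernel (κ t)],
          (∀ (t : ℝ≥0) (x : GaugeConfig 3 ((F.P K).sitesPerDir 0) (Matrix.specialUnitaryGroup (Fin 2) ℂ))
            (Ω : Type) [MeasurableSpace Ω] (P : Measure Ω) [IsProbabilityMeasure P]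
            (W : ℝ≥0 → Ω → (Edge 3 ((F.P K).sitesPerDir 0) × NoiseIdx 2 → ℝ)) (hW : IsFlatBrownian W P)
            (U : ℝ≥0 → Ω → GaugeConfig 3 ((F.P K).sitesPerDir 0) (Matrix.specialUnitaryGroup (Fin 2) ℂ)),
            (∀ ω, U 0 ω = x) →
            (latticeLangevinDynamics (fundamentalLatticeRep 2) ((γ * (F.P K).eps)⁻¹ / 2)).IsSolution (fundamentalRep (Fin 2))
              hW.natFiltration P W U →
            κ t x = P.map (U t)) →
          ∀ (G : GaugeConfig 3 ((F.P K).sitesPerDir 0) (Matrix.specialUnitaryGroup (Fin 2) ℂ) → ℝ), Measurable G →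
            (∀ x, |G x| ≤ 1) → ∀ t : ℝ≥0,
            ∫ x, ((∫ y, G y ∂(κ t x)) - ∫ z, G z ∂(wilsonMeasure (d := 3) (L := (F.P K).sitesPerDir 0)
                (fundamentalRep (Fin 2)) ((γ * (F.P K).eps)⁻¹ / 2))) ^ 2
                ∂(wilsonMeasure (d := 3) (L := (F.P K).sitesPerDir 0) (fundamentalRep (Fin 2)) ((γ * (F.P K).eps)⁻¹ / 2)) ≤
              Real.exp (-2 * c * ((F.P K).eps * t)) *
                ∫ x, (G x - ∫ z, G z ∂(wilsonMeasure (d := 3) (L := (F.P K).sitesPerDir 0)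
                  (fundamentalRep (Fin 2)) ((γ * (F.P K).eps)⁻¹ / 2))) ^ 2
                  ∂(wilsonMeasure (d := 3) (L := (F.P K).sitesPerDir 0) (fundamentalRep (Fin 2)) ((γ * (F.P K).eps)⁻¹ / 2))) →
    (∃ γ₁ : ℝ, 0 < γ₁ ∧ ∀ (F : T3ContinuumYM3Torus.T3Family) (γ : ℝ), 0 < γ → γ ≤ γ₁ →
      ∃ s₀ X₀ : ℝ, 0 < s₀ ∧ 0 ≤ X₀ ∧ ∃ K₀ : ℕ, ∀ K : ℕ, K₀ ≤ K →
        ∀ (Ω : Type) (mΩ : MeasurableSpace Ω) (P : Measure Ω) (_ : IsProbabilityMeasure P)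
          (W : ℝ≥0 → Ω → (Edge 3 ((F.P K).sitesPerDir 0) × NoiseIdx 2 → ℝ)) (hW : IsFlatBrownian W P)
          (U : ℝ≥0 → Ω → GaugeConfig 3 ((F.P K).sitesPerDir 0) (Matrix.specialUnitaryGroup (Fin 2) ℂ)),
          ((∀ ω, U 0 ω = fun _ => 1) ∧
            (latticeLangevinDynamics (⟨2, fundamentalRep (Fin 2), continuous_fundamentalRep _,
                Literature.MathematicalPhysics.QuantumLattice.fundamentalRep_injective _,
                Literature.MathematicalPhysics.QuantumLattice.fundamentalRep_mem_unitaryGroup⟩ :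
                LatticeRep (Matrix.specialUnitaryGroup (Fin 2) ℂ)) ((γ * (F.P K).eps)⁻¹ / 2)).IsSolution
              (fundamentalRep (Fin 2)) hW.natFiltration P W U) →
          ∀ (G : GaugeConfig 3 ((F.P K).sitesPerDir 0) (Matrix.specialUnitaryGroup (Fin 2) ℂ) → ℝ), Measurable G →
            (∀ x, |G x| ≤ 1) →
            ((∫ ω, G (U (s₀ / (F.P K).eps).toNNReal ω) ∂P) - ∫ z, G z ∂(wilsonMeasure (d := 3) (L := (F.P K).sitesPerDir 0)
                (fundamentalRep (Fin 2)) ((γ * (F.P K).eps)⁻¹ / 2))) ^ 2 ≤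
              X₀ * ∫ x, (G x - ∫ z, G z ∂(wilsonMeasure (d := 3) (L := (F.P K).sitesPerDir 0)
                (fundamentalRep (Fin 2)) ((γ * (F.P K).eps)⁻¹ / 2))) ^ 2
                ∂(wilsonMeasure (d := 3) (L := (F.P K).sitesPerDir 0) (fundamentalRep (Fin 2)) ((γ * (F.P K).eps)⁻¹ / 2))) →
    (∃ γ₁ : ℝ, 0 < γ₁ ∧ ∀ (F : T3ContinuumYM3Torus.T3Family) (γ : ℝ), 0 < γ → γ ≤ γ₁ →
      ∀ (os : List (T3ContinuumYM3Torus.ULoop3 F)) (η : ℝ), 0 < η →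
        ∃ Tc : ℝ, 0 < Tc ∧ ∃ K₀ : ℕ, ∀ K : ℕ, K₀ ≤ K →
          ∀ (Ω : Type) (mΩ : MeasurableSpace Ω) (P : Measure Ω) (_ : IsProbabilityMeasure P)
            (W : ℝ≥0 → Ω → (Edge 3 ((F.P K).sitesPerDir 0) × NoiseIdx 2 → ℝ)) (hW : IsFlatBrownian W P)
            (U : ℝ≥0 → Ω → GaugeConfig 3 ((F.P K).sitesPerDir 0) (Matrix.specialUnitaryGroup (Fin 2) ℂ)),
            ((∀ ω, U 0 ω = fun _ => 1) ∧
              (latticeLangevinDynamics (⟨2, fundamentalRep (Fin 2), continuous_fundamentalRep _,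
                  Literature.MathematicalPhysics.QuantumLattice.fundamentalRep_injective _,
                  Literature.MathematicalPhysics.QuantumLattice.fundamentalRep_mem_unitaryGroup⟩ :
                  LatticeRep (Matrix.specialUnitaryGroup (Fin 2) ℂ)) ((γ * (F.P K).eps)⁻¹ / 2)).IsSolution
                (fundamentalRep (Fin 2)) hW.natFiltration P W U) →
              ∀ s : ℝ, Tc ≤ s →
                |(F.scheme (ExpMeanLog.expMeanLogSU : LoopAverage (Matrix.specialUnitaryGroup (Fin 2) ℂ)) γ).expectAt
                      K os -
                    ∫ ω, (os.map fun C => F.avgObs (ExpMeanLog.expMeanLogSU :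
                        LoopAverage (Matrix.specialUnitaryGroup (Fin 2) ℂ)) K C
                      (fun b : PBond (F.P K) 0 => U (s / (F.P K).eps).toNNReal ω (b.src, b.dir))).prod ∂P| ≤ η) := by
  rintro ⟨γa, hγa, hA⟩ ⟨γb, hγb, hB⟩
  refine ⟨min γa γb, lt_min hγa hγb, fun F γ hγ hγle os η hη => ?_⟩
  obtain ⟨c, hc, Ka, hKa⟩ := hA F γ hγ (hγle.trans (min_le_left _ _))
  obtain ⟨s₀, X₀, hs₀, hX₀, Kb, hKb⟩ := hB F γ hγ (hγle.trans (min_le_right _ _))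
  -- the physical horizon `T` with `X₀ e^{-2cT} ≤ η²`
  set T : ℝ := max 1 (Real.log ((X₀ + 1) / η ^ 2) / (2 * c)) with hT
  have hT1 : 1 ≤ T := le_max_left _ _
  have hT0 : 0 < T := lt_of_lt_of_le one_pos hT1
  have hexpT : ∀ τ : ℝ, T ≤ τ → X₀ * Real.exp (-2 * c * τ) ≤ η ^ 2 := by
    intro τ hτ
    have hη2 : 0 < η ^ 2 := by positivity
    have hlog : Real.log ((X₀ + 1) / η ^ 2) ≤ 2 * c * τ := by
      have h := le_trans (le_max_right _ _) hτ
      rw [div_le_iff₀ (by positivity)] at h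
      linarith [mul_comm τ (2 * c)]
    have h1 : Real.exp (-2 * c * τ) ≤ Real.exp (-Real.log ((X₀ + 1) / η ^ 2)) := Real.exp_le_exp.2 (by linarith)
    rw [Real.exp_neg, Real.exp_log (by positivity), inv_div] at h1
    calc X₀ * Real.exp (-2 * c * τ) ≤ X₀ * (η ^ 2 / (X₀ + 1)) := mul_le_mul_of_nonneg_left h1 hX₀
      _ ≤ (X₀ + 1) * (η ^ 2 / (X₀ + 1)) := mul_le_mul_of_nonneg_right (by linarith) (by positivity)
      _ = η ^ 2 := mul_div_cancel₀ _ (by positivity)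
  refine ⟨s₀ + T, by positivity, max Ka Kb, fun K hK => ?_⟩
  classical
  -- notation at the cut-off `K` (before introducing the solution, so that nothing is shadowed)
  set ε : ℝ := (F.P K).eps with hεdef
  have hε : 0 < ε := (F.P K).eps_pos
  set β' : ℝ := (γ * ε)⁻¹ / 2 with hβ'
  set Lk : ℕ := (F.P K).sitesPerDir 0 with hLk
  haveI := secondCountableTopology_su2
  haveI := borelSpace_config Lk
  intro Ω mΩ P hP W hW U hU s hs
  obtain ⟨hU0, hsol⟩ := hU
  set μ : Measure (GaugeConfig 3 Lk (Matrix.specialUnitaryGroup (Fin 2) ℂ)) :=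
    wilsonMeasure (d := 3) (L := Lk) (fundamentalRep (Fin 2)) β' with hμ
  haveI hμP : IsProbabilityMeasure μ :=
    isProbabilityMeasure_wilsonMeasure (d := 3) (L := Lk) (fundamentalRep (Fin 2)) (continuous_fundamentalRep (Fin 2)) β'
  set S := F.scheme (ExpMeanLog.expMeanLogSU : LoopAverage (Matrix.specialUnitaryGroup (Fin 2) ℂ)) γ with hS
  have hβK : ∀ K', 0 ≤ S.β K' := fun K' => F.scheme_β_nonneg _ hγ.le K'
  -- THE kernels at this cut-off
  obtain ⟨κ, hκ, -, hreal⟩ := exists_transitionKernel Lk β'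
  haveI := hκ
  -- lattice times: `t₀ = s₀/ε`, `t₁ = s/ε = t₀ + t` with `ε t = s − s₀ ≥ T`
  have hs₀s : s₀ ≤ s := by linarith
  have ht₀r : 0 ≤ s₀ / ε := by positivity
  have ht₁r : 0 ≤ s / ε := div_nonneg (by linarith) hε.le
  set t₀ : ℝ≥0 := (s₀ / ε).toNNReal with ht₀
  set t : ℝ≥0 := ((s - s₀) / ε).toNNReal with htdef
  have htr : 0 ≤ (s - s₀) / ε := div_nonneg (by linarith) hε.le
  have ht₁ : (s / (F.P K).eps).toNNReal = t₀ + t := by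
    rw [ht₀, htdef, ← Real.toNNReal_add ht₀r htr]
    congr 1
    rw [← hεdef]
    field_simp
    ring
  have hεt : ε * (t : ℝ) = s - s₀ := by
    rw [htdef, Real.coe_toNNReal _ htr]
    field_simp
  -- the dictionary and the observable
  set dict : GaugeConfig 3 Lk (Matrix.specialUnitaryGroup (Fin 2) ℂ) → GaugeField (F.P K) 0 (Matrix.specialUnitaryGroup (Fin 2) ℂ) :=
    fun V => fun b : PBond (F.P K) 0 => V (b.src, b.dir) with hdict
  have hΦ : Measurable dict := measurable_pi_lambda _ fun b => measurable_pi_apply _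
  set f : GaugeField (F.P K) 0 (Matrix.specialUnitaryGroup (Fin 2) ℂ) → ℝ :=
    fun V => (os.map fun C => F.avgObs (ExpMeanLog.expMeanLogSU :
        LoopAverage (Matrix.specialUnitaryGroup (Fin 2) ℂ)) K C V).prod with hf
  have hm : ∀ K' C, Measurable (S.obs K' C) := fun K' C =>
    F.measurable_avgObs (F.avgMeasurable_of_measurableE _ T4ApexTwoLevel.measurableE_expMeanLogSU) K' C
  have hfm : Measurable f := T4GenFunBounds.measurable_prodObs S hm K os
  have hfb : ∀ V, |f V| ≤ 1 := fun V =>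
    T4GenFunBounds.abs_prodObs_le_one S (fun K' C U => F.abs_avgObs_le_one _ K' C U) K os V
  set G₀ : GaugeConfig 3 Lk (Matrix.specialUnitaryGroup (Fin 2) ℂ) → ℝ := fun V => f (dict V) with hG₀
  have hG₀m : Measurable G₀ := hfm.comp hΦ
  have hG₀b : ∀ V, |G₀ V| ≤ 1 := fun V => hfb _
  -- `expectAt = ∫ G₀ dμ`
  have hE : S.expectAt K os = ∫ V, G₀ V ∂μ := by
    have hE0 : S.expectAt K os = ∫ V, f V ∂(T4GenFunBounds.gibbsMeasure (F.P K) (S.β K)) :=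
      T4GenFunBounds.expectAt_eq_integral_gibbs S hβK K os
    have hG : T4GenFunBounds.gibbsMeasure (F.P K) (S.β K) = μ.map dict :=
      gibbsMeasure_eq_map_wilsonMeasure (F.P K) (hβK K)
    rw [hE0, hG, integral_map hΦ.aemeasurable hfm.aestronglyMeasurable]
  -- the propagated observable `G₁ = κ_t G₀`
  set G₁ : GaugeConfig 3 Lk (Matrix.specialUnitaryGroup (Fin 2) ℂ) → ℝ := fun x => ∫ y, G₀ y ∂(κ t x) with hG₁
  have hG₁m : Measurable G₁ := (hG₀m.stronglyMeasurable.integral_kernel (κ := κ t)).measurable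
  have hG₁b : ∀ x, |G₁ x| ≤ 1 := fun x => abs_integral_le_of_abs_le_of_isProbabilityMeasure hG₀b
  have hG₀i : ∀ (ν : Measure (GaugeConfig 3 Lk (Matrix.specialUnitaryGroup (Fin 2) ℂ))) [IsProbabilityMeasure ν],
      Integrable G₀ ν := fun ν _ => integrable_of_abs_le ν hG₀m hG₀b
  -- Markov: `E f(dict U_{t₀+t}) = E G₁(U_{t₀})`
  have hmU : ∀ u : ℝ≥0, Measurable (U u) := fun u => (hsol.adapted u).mono (hW.natFiltration.le u) le_rfl
  have hMarkov : ∫ ω, G₀ (U (t₀ + t) ω) ∂P = ∫ ω, G₁ (U t₀ ω) ∂P := by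
    rw [← integral_map (hmU (t₀ + t)).aemeasurable hG₀m.aestronglyMeasurable,
      ← integral_map (hmU t₀).aemeasurable hG₁m.aestronglyMeasurable,
      ← hreal (t₀ + t) (fun _ => 1) Ω P W hW U hU0 hsol, ← hreal t₀ (fun _ => 1) Ω P W hW U hU0 hsol,
      chapmanKolmogorov_szz β' κ hreal t₀ t]
    haveI : IsProbabilityMeasure ((κ t ∘ₖ κ t₀) (fun _ => 1)) := by
      rw [← chapmanKolmogorov_szz β' κ hreal t₀ t]; infer_instance
    exact Kernel.integral_comp (hG₀i _)
  -- invariance: `μ G₁ = μ G₀`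
  have hinv : ∫ x, G₁ x ∂μ = ∫ x, G₀ x ∂μ :=
    integral_transitionKernel_integral_eq_wilson (L := Lk) β' κ hreal t hG₀m ⟨1, hG₀b⟩
  -- (H2) on `G₁`, then (H1) on `G₀`
  have h2 := hKb K ((le_max_right _ _).trans hK) Ω mΩ P hP W hW U ⟨hU0, hsol⟩ G₁ hG₁m hG₁b
  rw [← ht₀] at h2
  have h1 := hKa K ((le_max_left _ _).trans hK) κ hreal G₀ hG₀m hG₀b t
  have hV1 : ∫ x, (G₀ x - ∫ z, G₀ z ∂μ) ^ 2 ∂μ ≤ 1 := integral_sub_integral_sq_le_one μ hG₀m hG₀b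
  -- assemble
  have hfin : ((∫ ω, G₀ (U (t₀ + t) ω) ∂P) - ∫ V, G₀ V ∂μ) ^ 2 ≤ η ^ 2 := by
    rw [hMarkov, ← hinv]
    calc ((∫ ω, G₁ (U t₀ ω) ∂P) - ∫ x, G₁ x ∂μ) ^ 2
        ≤ X₀ * ∫ x, (G₁ x - ∫ z, G₁ z ∂μ) ^ 2 ∂μ := h2
      _ = X₀ * ∫ x, ((∫ y, G₀ y ∂(κ t x)) - ∫ z, G₀ z ∂μ) ^ 2 ∂μ := by rw [hinv]
      _ ≤ X₀ * (Real.exp (-2 * c * (ε * t)) * ∫ x, (G₀ x - ∫ z, G₀ z ∂μ) ^ 2 ∂μ) :=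
          mul_le_mul_of_nonneg_left h1 hX₀
      _ ≤ X₀ * (Real.exp (-2 * c * (ε * t)) * 1) :=
          mul_le_mul_of_nonneg_left (mul_le_mul_of_nonneg_left hV1 (Real.exp_pos _).le) hX₀
      _ = X₀ * Real.exp (-2 * c * (s - s₀)) := by rw [mul_one, hεt]
      _ ≤ η ^ 2 := hexpT (s - s₀) (by linarith)
  have hfX : (fun ω => (os.map fun C => F.avgObs (ExpMeanLog.expMeanLogSU :
      LoopAverage (Matrix.specialUnitaryGroup (Fin 2) ℂ)) K C
        (fun b : PBond (F.P K) 0 => U (s / (F.P K).eps).toNNReal ω (b.src, b.dir))).prod) =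
      fun ω => G₀ (U (t₀ + t) ω) := by
    funext ω; rw [ht₁]
  rw [hfX, hE]
  have habs := Real.sqrt_le_sqrt hfin
  rw [Real.sqrt_sq_eq_abs, Real.sqrt_sq hη.le] at habs
  rwa [abs_sub_comm] at habs

/-! ## The rungs: both hypotheses hold at each fixed cut-off -/

/-- **RUNG for (H1)**: at ONE cut-off `K` the `L²(μ_K)` gap in physical units holds with some `c = c_K > 0`
(`wilson_spectralGap_measurable` with `c := c_K/ε_K`).  The content of (H1) is the K-uniformity of `c`. [folklore] -/
theorem uniformL2Gap_fixedCutoff (F : T3ContinuumYM3Torus.T3Family) (γ : ℝ) (K : ℕ) :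
    ∃ c : ℝ, 0 < c ∧
      ∀ (κ : ℝ≥0 → Kernel (GaugeConfig 3 ((F.P K).sitesPerDir 0) (Matrix.specialUnitaryGroup (Fin 2) ℂ))
          (GaugeConfig 3 ((F.P K).sitesPerDir 0) (Matrix.specialUnitaryGroup (Fin 2) ℂ))) [∀ t, IsMarkovKernel (κ t)],
        (∀ (t : ℝ≥0) (x : GaugeConfig 3 ((F.P K).sitesPerDir 0) (Matrix.specialUnitaryGroup (Fin 2) ℂ))
          (Ω : Type) [MeasurableSpace Ω] (P : Measure Ω) [IsProbabilityMeasure P]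
          (W : ℝ≥0 → Ω → (Edge 3 ((F.P K).sitesPerDir 0) × NoiseIdx 2 → ℝ)) (hW : IsFlatBrownian W P)
          (U : ℝ≥0 → Ω → GaugeConfig 3 ((F.P K).sitesPerDir 0) (Matrix.specialUnitaryGroup (Fin 2) ℂ)),
          (∀ ω, U 0 ω = x) →
          (latticeLangevinDynamics (fundamentalLatticeRep 2) ((γ * (F.P K).eps)⁻¹ / 2)).IsSolution (fundamentalRep (Fin 2))
            hW.natFiltration P W U →
          κ t x = P.map (U t)) →
        ∀ (G : GaugeConfig 3 ((F.P K).sitesPerDir 0) (Matrix.specialUnitaryGroup (Fin 2) ℂ) → ℝ), Measurable G →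
          (∀ x, |G x| ≤ 1) → ∀ t : ℝ≥0,
          ∫ x, ((∫ y, G y ∂(κ t x)) - ∫ z, G z ∂(wilsonMeasure (d := 3) (L := (F.P K).sitesPerDir 0)
              (fundamentalRep (Fin 2)) ((γ * (F.P K).eps)⁻¹ / 2))) ^ 2
              ∂(wilsonMeasure (d := 3) (L := (F.P K).sitesPerDir 0) (fundamentalRep (Fin 2)) ((γ * (F.P K).eps)⁻¹ / 2)) ≤
            Real.exp (-2 * c * ((F.P K).eps * t)) *
              ∫ x, (G x - ∫ z, G z ∂(wilsonMeasure (d := 3) (L := (F.P K).sitesPerDir 0)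
                (fundamentalRep (Fin 2)) ((γ * (F.P K).eps)⁻¹ / 2))) ^ 2
                ∂(wilsonMeasure (d := 3) (L := (F.P K).sitesPerDir 0) (fundamentalRep (Fin 2)) ((γ * (F.P K).eps)⁻¹ / 2)) := by
  have hε : 0 < (F.P K).eps := (F.P K).eps_pos
  obtain ⟨c, hc, hgap⟩ := wilson_spectralGap_measurable ((F.P K).sitesPerDir 0) ((γ * (F.P K).eps)⁻¹ / 2)
  refine ⟨c / (F.P K).eps, div_pos hc hε, fun κ _ hreal G hG hG1 t => ?_⟩
  have h := (hgap κ hreal).1 G hG 1 hG1 t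
  have e : -2 * (c / (F.P K).eps) * ((F.P K).eps * (t : ℝ)) = -2 * c * t := by
    field_simp
  rw [e]
  exact h

/-- **RUNG for (H2)**: at ONE cut-off `K` the cold-start χ² budget (dual form) holds at the physical time `s₀ := ε_K`
(lattice time `1`) with some `X₀ = D_K ≥ 0` (`coldStart_measurable_sq_sub_le_exp` at `t = 0`).  The content of (H2) is the
K-uniformity of `(s₀, X₀)`. [folklore] -/
theorem coldChiSquareBudget_fixedCutoff (F : T3ContinuumYM3Torus.T3Family) (γ : ℝ) (K : ℕ) :
    ∃ s₀ X₀ : ℝ, 0 < s₀ ∧ 0 ≤ X₀ ∧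
      ∀ (Ω : Type) (mΩ : MeasurableSpace Ω) (P : Measure Ω) (_ : IsProbabilityMeasure P)
        (W : ℝ≥0 → Ω → (Edge 3 ((F.P K).sitesPerDir 0) × NoiseIdx 2 → ℝ)) (hW : IsFlatBrownian W P)
        (U : ℝ≥0 → Ω → GaugeConfig 3 ((F.P K).sitesPerDir 0) (Matrix.specialUnitaryGroup (Fin 2) ℂ)),
        ((∀ ω, U 0 ω = fun _ => 1) ∧
          (latticeLangevinDynamics (⟨2, fundamentalRep (Fin 2), continuous_fundamentalRep _,
              Literature.MathematicalPhysics.QuantumLattice.fundamentalRep_injective _,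
              Literature.MathematicalPhysics.QuantumLattice.fundamentalRep_mem_unitaryGroup⟩ :
              LatticeRep (Matrix.specialUnitaryGroup (Fin 2) ℂ)) ((γ * (F.P K).eps)⁻¹ / 2)).IsSolution
            (fundamentalRep (Fin 2)) hW.natFiltration P W U) →
        ∀ (G : GaugeConfig 3 ((F.P K).sitesPerDir 0) (Matrix.specialUnitaryGroup (Fin 2) ℂ) → ℝ), Measurable G →
          (∀ x, |G x| ≤ 1) →
          ((∫ ω, G (U (s₀ / (F.P K).eps).toNNReal ω) ∂P) - ∫ z, G z ∂(wilsonMeasure (d := 3) (L := (F.P K).sitesPerDir 0)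
              (fundamentalRep (Fin 2)) ((γ * (F.P K).eps)⁻¹ / 2))) ^ 2 ≤
            X₀ * ∫ x, (G x - ∫ z, G z ∂(wilsonMeasure (d := 3) (L := (F.P K).sitesPerDir 0)
              (fundamentalRep (Fin 2)) ((γ * (F.P K).eps)⁻¹ / 2))) ^ 2
              ∂(wilsonMeasure (d := 3) (L := (F.P K).sitesPerDir 0) (fundamentalRep (Fin 2)) ((γ * (F.P K).eps)⁻¹ / 2)) := by
  have hε : 0 < (F.P K).eps := (F.P K).eps_pos
  obtain ⟨c, -, hcold⟩ := coldStart_measurable_sq_sub_le_exp ((F.P K).sitesPerDir 0) ((γ * (F.P K).eps)⁻¹ / 2)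
  obtain ⟨D, hD, hD'⟩ := hcold (fun _ => 1) 1 (by norm_num)
  refine ⟨(F.P K).eps, D, hε, hD, fun Ω mΩ P hP W hW U hU G hG hG1 => ?_⟩
  have ht : ((F.P K).eps / (F.P K).eps).toNNReal = (1 : ℝ≥0) + 0 := by
    rw [div_self hε.ne', add_zero, Real.toNNReal_one]
  have h := (hD' Ω P W hW U hU.1 hU.2).1 G hG 1 hG1 0
  rw [ht]
  simpa using h

end Summit.QuantumFields.YangMills.Theorems.ColdStartUniversality

end
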